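import Literature.Analysis.FunctionSpaces.MeyersSerrinProofs
import Mathlib.Analysis.Calculus.BumpFunction.Convolution
import HarnessLib

/-!
# C177 `Wu2026` — Prop 3.3 toolkit (part 2): measurable weak partials and interior smoothing
# with two exponents

D-0090 NS-CLAIMS sweep, claim C177 (W. Wu, arXiv:2608.22471v1), skeleton
`Literature/Claims/NS/Wu2026.lean`; kernel objects for the binder `hP33` of `claim_of_steps''`
(Proposition 3.3 p.20, `Step_P33`). The field `Tangent.sobolev` of the skeleton records (3.35)
«V ∈ W^{1,9/5}_loc({|y| > 1}) ∩ L^{9/2}_loc({|y| > 1})» as a weak-gradient identity against test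
functions, with the integrability of `|∇V|^{9/5}` but no measurability clause on the gradient
columns; and the printed proof of Prop 3.3 («By the Sobolev chain and product rules, see, for
example, [1]», p.20 l.81–82) is an approximation argument. This file supplies the two generic
pieces, in the vocabulary of the tree's `Literature.Analysis.FunctionSpaces.HasWeakFDerivOn`:

* `exists_locallyIntegrableOn_weakPartial` — a weak partial derivative `g` of a locally
  integrable `f` (identity `∫ ∂ᵥφ • f = −∫ φ • g` for all test functions on `U`, no hypothesis on
  `g`) can be replaced by a locally integrable `g'` with `‖g'‖ ≤ ‖g‖` satisfying the same identity
  (either every `φ • g` is integrable, and `g' = g` is locally integrable; or one is not, and then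
  the Bochner convention `∫ = 0` forces `∫ ∂ᵥφ • f = 0` for all `φ`, so `g' = 0` works);
* `exists_smooth_approx_two_exponents` — interior mollification (Evans, *PDE*, §5.3.1 Thm. 1;
  Adams 1975, Lemma 3.15): if `f ∈ L^p(Ω)` has the weak derivative `g ∈ L^q(Ω)` on the open set
  `Ω` (`1 ≤ p, q < ∞`, possibly `p ≠ q`), then on every compact `K ⊆ Ω` there are smooth `uₙ`
  with `uₙ → f` in `L^p(K)` and a.e. on `K`, and `Duₙ → g` in `L^q(K)`; built from the tree's
  `SobolevApprox.tendsto_eLpNorm_restrict_sub_normed_convolution` /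
  `fderiv_convolution_apply_of_tsupport_subset` and Mathlib's Lebesgue differentiation
  `ContDiffBump.ae_convolution_tendsto_right_of_locallyIntegrable`.

Seat ns-in-wu-p33 (cell pub/ns-inputs, D-0154 (2) INPUTS). WHAT THIS IS NOT: not a claim about
NS regularity or blow-up; no summit statement is proved here.
-/

noncomputable section

set_option linter.dupNamespace false

open MeasureTheory TopologicalSpace Set Function Filter Topology Metric ContinuousLinearMap
open scoped ENNReal NNReal Topology ContDiff Convolution

namespace Summit.NavierStokesRegularity.NavierStokesRegularity.Theorems.Wu2026Salvage

open Literature.Analysis.FunctionSpaces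

variable {E : Type*} [NormedAddCommGroup E] [NormedSpace ℝ E] [FiniteDimensional ℝ E]
  [MeasurableSpace E] [BorelSpace E] {μ : Measure E} [μ.IsAddHaarMeasure]
variable {F : Type*} [NormedAddCommGroup F] [NormedSpace ℝ F] [CompleteSpace F]

/-! ### Integrability of test pairings -/

omit [NormedSpace ℝ E] [FiniteDimensional ℝ E] [BorelSpace E] [μ.IsAddHaarMeasure]
  [CompleteSpace F] in
/-- A continuous compactly supported scalar function with support in the open set `U`, times a
function locally integrable on `U`, is integrable on the whole space. [folklore] -/
theorem integrable_smul_of_tsupport_subset [OpensMeasurableSpace E] {U : Set E} (hU : IsOpen U)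
    {ψ : E → ℝ} {h : E → F} (hψ : Continuous ψ) (hψc : HasCompactSupport ψ)
    (hψU : tsupport ψ ⊆ U) (hh : LocallyIntegrableOn h U μ) :
    Integrable (fun x => ψ x • h x) μ := by
  have h1 : IntegrableOn (fun x => ψ x • h x) U μ :=
    SobolevApprox.integrableOn_continuous_smul (Ω := ⟨U, hU⟩) hψ hψc hψU hh
  refine (integrableOn_iff_integrable_of_support_subset ?_).1 h1
  intro x hx
  exact hψU (subset_tsupport _ (support_smul_subset_left _ _ hx))

omit [FiniteDimensional ℝ E] [BorelSpace E] [μ.IsAddHaarMeasure] [CompleteSpace F] in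
/-- For a test function `φ` on the open set `U` and `f` locally integrable on `U`,
`x ↦ ∂ᵥφ(x) • f x` is integrable on the whole space. [folklore] -/
theorem integrable_fderiv_smul_of_tsupport_subset [OpensMeasurableSpace E] {U : Set E}
    (hU : IsOpen U) {φ : E → ℝ} {f : E → F} (hφ : ContDiff ℝ ∞ φ) (hφc : HasCompactSupport φ)
    (hφU : tsupport φ ⊆ U) (hf : LocallyIntegrableOn f U μ) (v : E) :
    Integrable (fun x => (fderiv ℝ φ x v) • f x) μ :=
  integrable_smul_of_tsupport_subset hU
    ((hφ.continuous_fderiv (by simp)).clm_apply continuous_const)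
    (hφc.fderiv_apply (𝕜 := ℝ) v) ((tsupport_fderiv_apply_subset ℝ v).trans hφU) hf

/-! ### Replacing a weak partial derivative by a locally integrable one -/

omit [μ.IsAddHaarMeasure] [CompleteSpace F] in
/-- **Measurable modification of a weak partial derivative.** Let `f` be locally integrable on
the open set `U` and suppose `∫ ∂ᵥφ • f = −∫ φ • g` for every test function `φ` on `U`, for some
function `g` about which nothing else is known. Then there is `g'`, locally integrable on `U`,
with `‖g' x‖ ≤ ‖g x‖` everywhere and the same identity. (If every `φ • g` is integrable, `g' = g`
is locally integrable — test with a cut-off equal to `1` on a compact; otherwise some `φ₀ • g`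
is not integrable, its Bochner integral is `0`, hence `∫ ∂ᵥφ₀ • f = 0`, and by linearity in the
test function `∫ ∂ᵥφ • f = 0` for every `φ`, so `g' = 0` works.) [folklore] -/
theorem exists_locallyIntegrableOn_weakPartial {U : Set E} (hU : IsOpen U) {f g : E → F} {v : E}
    (hf : LocallyIntegrableOn f U μ)
    (hid : ∀ φ : E → ℝ, ContDiff ℝ ∞ φ → HasCompactSupport φ → tsupport φ ⊆ U →
      ∫ x, (fderiv ℝ φ x v) • f x ∂μ = -∫ x, φ x • g x ∂μ) :
    ∃ g' : E → F, LocallyIntegrableOn g' U μ ∧ (∀ x, ‖g' x‖ ≤ ‖g x‖) ∧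
      ∀ φ : E → ℝ, ContDiff ℝ ∞ φ → HasCompactSupport φ → tsupport φ ⊆ U →
        ∫ x, (fderiv ℝ φ x v) • f x ∂μ = -∫ x, φ x • g' x ∂μ := by
  by_cases hint : ∀ φ : E → ℝ, ContDiff ℝ ∞ φ → HasCompactSupport φ → tsupport φ ⊆ U →
      Integrable (fun x => φ x • g x) μ
  · refine ⟨g, ?_, fun x => le_rfl, hid⟩
    rw [locallyIntegrableOn_iff hU.isLocallyClosed]
    intro K hKU hK
    obtain ⟨χ, hχ, hχc, hχU, hχK⟩ := MeyersSerrin.exists_smooth_cutoff hK hU hKU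
    have hi := (hint χ hχ hχc hχU).integrableOn (s := K)
    refine hi.congr_fun (fun x hx => ?_) hK.measurableSet
    show χ x • g x = g x
    rw [hχK.self_of_nhdsSet x hx, one_smul]
  · push Not at hint
    obtain ⟨φ₀, hφ₀, hφ₀c, hφ₀U, hφ₀i⟩ := hint
    refine ⟨0, (integrable_zero E F μ).locallyIntegrable.locallyIntegrableOn U,
      fun x => by simp, fun φ hφ hφc hφU => ?_⟩
    simp only [Pi.zero_apply, smul_zero, integral_zero, neg_zero]
    have h0 : ∫ x, (fderiv ℝ φ₀ x v) • f x ∂μ = 0 := by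
      rw [hid φ₀ hφ₀ hφ₀c hφ₀U, integral_undef hφ₀i, neg_zero]
    by_cases hφi : Integrable (fun x => φ x • g x) μ
    · -- `(φ₀ + φ) • g` is not integrable, so both `φ₀` and `φ₀ + φ` pair to zero
      have hsum : ¬Integrable (fun x => (φ₀ x + φ x) • g x) μ := by
        intro h
        apply hφ₀i
        have := h.sub hφi
        refine this.congr (Eventually.of_forall fun x => ?_)
        simp only [Pi.sub_apply, add_smul, add_sub_cancel_right]
      have hs : ContDiff ℝ ∞ (fun x => φ₀ x + φ x) := hφ₀.add hφ
      have hsc : HasCompactSupport (fun x => φ₀ x + φ x) := hφ₀c.add hφc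
      have hsU : tsupport (fun x => φ₀ x + φ x) ⊆ U :=
        (tsupport_add (f := φ₀) (g := φ)).trans (union_subset hφ₀U hφU)
      have h1 : ∫ x, (fderiv ℝ (fun x => φ₀ x + φ x) x v) • f x ∂μ = 0 := by
        rw [hid _ hs hsc hsU, integral_undef hsum, neg_zero]
      have hd₀ : Differentiable ℝ φ₀ := hφ₀.differentiable (by simp)
      have hd : Differentiable ℝ φ := hφ.differentiable (by simp)
      have e : (fun x => (fderiv ℝ (fun x => φ₀ x + φ x) x v) • f x) =
          fun x => (fderiv ℝ φ₀ x v) • f x + (fderiv ℝ φ x v) • f x := by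
        funext x
        rw [show (fun x => φ₀ x + φ x) = φ₀ + φ from rfl, fderiv_add (hd₀ x) (hd x),
          FunLike.coe_add, Pi.add_apply, add_smul]
      rw [e, integral_add (integrable_fderiv_smul_of_tsupport_subset hU hφ₀ hφ₀c hφ₀U hf v)
        (integrable_fderiv_smul_of_tsupport_subset hU hφ hφc hφU hf v), h0, zero_add] at h1
      exact h1
    · rw [hid φ hφ hφc hφU, integral_undef hφi, neg_zero]

/-! ### Interior smoothing with two exponents -/

omit [NormedSpace ℝ E] [FiniteDimensional ℝ E] [MeasurableSpace E] [BorelSpace E] in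
/-- Centred bump functions with outer radii `δ/(n+1) → 0`, all `≤ δ`, and radius ratio `≤ 2`
(so that Lebesgue differentiation applies to the mollified sequence). [folklore] -/
theorem exists_contDiffBump_seq_le {δ : ℝ} (hδ : 0 < δ) :
    ∃ φ : ℕ → ContDiffBump (0 : E), Tendsto (fun n => (φ n).rOut) atTop (𝓝 0) ∧
      (∀ n, (φ n).rOut ≤ 2 * (φ n).rIn) ∧ ∀ n, (φ n).rOut ≤ δ := by
  have hrad : ∀ n : ℕ, δ / ((n : ℝ) + 2) < δ / ((n : ℝ) + 1) := fun n =>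
    div_lt_div_of_pos_left hδ (by positivity) (by linarith)
  refine ⟨fun n => ⟨δ / ((n : ℝ) + 2), δ / ((n : ℝ) + 1), by positivity, hrad n⟩, ?_,
    fun n => ?_, fun n => ?_⟩
  · show Tendsto (fun n : ℕ => δ / ((n : ℝ) + 1)) atTop (𝓝 0)
    have := tendsto_one_div_add_atTop_nhds_zero_nat.const_mul δ
    rw [mul_zero] at this
    refine this.congr fun n => ?_
    rw [mul_one_div]
  · show δ / ((n : ℝ) + 1) ≤ 2 * (δ / ((n : ℝ) + 2))
    rw [mul_div_assoc', div_le_div_iff₀ (by positivity) (by positivity)]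
    nlinarith [hδ.le, (Nat.cast_nonneg n : (0 : ℝ) ≤ n)]
  · show δ / ((n : ℝ) + 1) ≤ δ
    exact div_le_self hδ.le (by linarith [(Nat.cast_nonneg n : (0 : ℝ) ≤ n)])

/-- **Interior mollification with two exponents** (Evans, *PDE*, §5.3.1 Thm. 1; Adams, *Sobolev
Spaces* (1975), Lemma 3.15 «`J_ε ∗ u → u` in `W^{m,p}(Ω')` for `Ω' ⊂⊂ Ω`», here with the
function in `L^p` and the derivative in `L^q`). Let `g` be a weak derivative of `f` on the open
set `Ω` with `f ∈ L^p(Ω)`, `g ∈ L^q(Ω)`, `1 ≤ p, q < ∞`, and `K ⊆ Ω` compact. Then there are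
`C^∞` functions `uₙ` on the whole space with `‖uₙ − f‖_{L^p(K)} → 0`,
`‖Duₙ − g‖_{L^q(K)} → 0`, and `uₙ → f` a.e. on `K`: the mollifications of the zero extension
of `f` by normalised bumps of radii `δ/(n+1)` where the closed `δ`-neighbourhood of `K` lies in
`Ω`. [cite: Evans2010, §5.3.1 Theorem 1] -/
theorem exists_smooth_approx_two_exponents {Ω : Opens E} {f : E → F} {g : E → E →L[ℝ] F}
    (hw : HasWeakFDerivOn Ω μ f g) {p q : ℝ≥0∞} (hp : 1 ≤ p) (hp' : p ≠ ⊤) (hq : 1 ≤ q)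
    (hq' : q ≠ ⊤) (hf : MemLp f p (μ.restrict Ω)) (hg : MemLp g q (μ.restrict Ω))
    {K : Set E} (hK : IsCompact K) (hKΩ : K ⊆ Ω) :
    ∃ u : ℕ → E → F, (∀ n, ContDiff ℝ ∞ (u n)) ∧
      Tendsto (fun n => eLpNorm (fun x => u n x - f x) p (μ.restrict K)) atTop (𝓝 0) ∧
      Tendsto (fun n => eLpNorm (fun x => fderiv ℝ (u n) x - g x) q (μ.restrict K)) atTop (𝓝 0) ∧
      ∀ᵐ x ∂(μ.restrict K), Tendsto (fun n => u n x) atTop (𝓝 (f x)) := by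
  have hΩm : MeasurableSet (Ω : Set E) := Ω.isOpen.measurableSet
  obtain ⟨δ, hδ, hδΩ⟩ := hK.exists_cthickening_subset_open Ω.isOpen hKΩ
  obtain ⟨φ, hr, hratio, hrδ⟩ := exists_contDiffBump_seq_le (E := E) hδ
  have hc : Tendsto (fun _ : ℕ => (0 : E)) atTop (𝓝 0) := tendsto_const_nhds
  -- zero extensions (all types pinned: unification through the operator-norm space is slow)
  have hGp : MemLp ((Ω : Set E).indicator f) p μ := (memLp_indicator_iff_restrict (ε := F) hΩm).2 hf
  have hg'q : MemLp ((Ω : Set E).indicator g) q μ :=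
    (memLp_indicator_iff_restrict (ε := E →L[ℝ] F) hΩm).2 hg
  have hGloc : LocallyIntegrable ((Ω : Set E).indicator f) μ := hGp.locallyIntegrable hp
  have hg'loc : LocallyIntegrable ((Ω : Set E).indicator g) μ := hg'q.locallyIntegrable hq
  have hw' : HasWeakFDerivOn Ω μ ((Ω : Set E).indicator f) ((Ω : Set E).indicator g) :=
    SobolevApprox.hasWeakFDerivOn_congr hw (fun x hx => indicator_of_mem hx f)
      (fun x hx => indicator_of_mem hx g)
  -- geometry: for `x ∈ K` the reflected kernel support lies in `Ω`
  have hgeo : ∀ n, ∀ x ∈ K, ∀ y ∈ tsupport ((φ n).normed μ), x - y ∈ (Ω : Set E) := by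
    intro n x hx y hy
    rw [(φ n).tsupport_normed_eq, mem_closedBall, dist_zero_right] at hy
    refine hδΩ (mem_cthickening_of_dist_le (x - y) x δ K hx ?_)
    rw [dist_eq_norm, sub_sub_cancel_left, norm_neg]
    exact hy.trans (hrδ n)
  -- the approximants
  refine ⟨fun n => (φ n).normed μ ⋆[lsmul ℝ ℝ, μ] (Ω : Set E).indicator f, fun n =>
    (φ n).hasCompactSupport_normed.contDiff_convolution_left _ (φ n).contDiff_normed hGloc,
    ?_, ?_, ?_⟩
  · -- `L^p(K)` convergence
    have h1 := SobolevApprox.tendsto_eLpNorm_restrict_sub_normed_convolution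
      (c := fun _ => (0 : E)) φ hc hr hp hp' hGp K
    refine (tendsto_congr fun n => ?_).1 h1
    rw [← eLpNorm_neg]
    refine eLpNorm_congr_ae (ae_restrict_of_forall_mem hK.measurableSet fun x hx => ?_)
    simp only [Pi.neg_apply, Pi.sub_apply, neg_sub, indicator_of_mem (hKΩ hx)]
  · -- `L^q(K)` convergence of the derivatives
    have h1 := SobolevApprox.tendsto_eLpNorm_restrict_sub_normed_convolution
      (c := fun _ => (0 : E)) φ hc hr hq hq' hg'q K
    refine (tendsto_congr fun n => ?_).1 h1
    rw [← eLpNorm_neg]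
    refine eLpNorm_congr_ae (ae_restrict_of_forall_mem hK.measurableSet fun x hx => ?_)
    have hD := (SobolevApprox.hasFDerivAt_convolution_of_tsupport_subset hw' hGloc hg'loc
      (φ n).contDiff_normed (φ n).hasCompactSupport_normed (hgeo n x hx)).fderiv
    simp only [Pi.neg_apply, Pi.sub_apply, neg_sub, hD, indicator_of_mem (hKΩ hx)]
  · -- a.e. convergence on `K`
    have hae := ContDiffBump.ae_convolution_tendsto_right_of_locallyIntegrable (μ := μ)
      (φ := φ) (l := atTop) (K := 2) hr (Eventually.of_forall hratio) hGloc
    refine (ae_restrict_iff' hK.measurableSet).2 ?_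
    filter_upwards [hae] with x hx hxK
    simpa only [indicator_of_mem (hKΩ hxK)] using hx

end Summit.NavierStokesRegularity.NavierStokesRegularity.Theorems.Wu2026Salvage
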